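import Literature.NumberTheory.Automorphic.FuchsianEisensteinGrowth
import Literature.NumberTheory.Automorphic.L2EigenvalueNonneg
import Literature.NumberTheory.Automorphic.SmallEigenbasisIndependence

/-!
# Lemma 6.4: uniqueness of the Eisenstein series of a finite volume Fuchsian group (`Re s > 1`)
(Iwaniec, *Spectral Methods of Automorphic Forms*, GSM 53, §6.3, Lemma 6.4, PDF p. 86; §3.2 (3.20),
PDF p. 46; §4.1 (4.3), PDF p. 48)

Sixth brick of the series `FuchsianGroupCusps` / `FuchsianEisensteinSeries` /
`FuchsianIncompleteEisenstein` / `FuchsianEisensteinGrowth` / `FuchsianIncompleteEisensteinCusp`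
towards the general finite-volume cases of `Iwaniec2002_thm_7_4` / `Iwaniec2002_eq_12_5` /
`Iwaniec2002_thm_12_1`, and the first statement of Chapter 6 for a GENERAL group: the uniqueness
principle from which the functional equation `ℰ(z, s) = Φ(s)ℰ(z, 1 - s)` (Theorem 6.5) is read
off once the Eisenstein series are continued. Everything is PROVED; nothing is vendored; no fact
is introduced.

1. (§1) **An automorphic function vanishing a.e. on a fundamental domain vanishes a.e. on `ℍ`**
   (`ae_eq_zero_of_isAutomorphic`: `{g ≠ 0} ⊆ ⋃_γ γ⁻¹{w ∈ F : g(w) ≠ 0}`, countably many null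
   sets by the invariance of `dμ`), hence identically if continuous
   (`eq_zero_of_isAutomorphic_of_ae_restrict`).
2. (§2) **Lemma 6.4** (`eq_sum_eisCusp_of_growth`): for a finite volume group (`Γ ≤ SL₂(ℝ)`
   discrete, `-1 ∈ Γ`, fundamental domain `F` of finite area) with a complete system of
   inequivalent cusps `𝔞ᵢ = σᵢ∞` with width-one scaling matrices
   (`FuchsianCuspZones.exists_cuspSystem`), `Re s > 1`, and `f ∈ 𝒜_s(Γ\ℍ)` (automorphic, `C²`,
   `(Δ + s(1-s))f = 0`) with `f(σᵢz) = αᵢ y^s + O(1)` uniformly in `y ≥ 1` at every cusp: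
   **`f = Σᵢ αᵢ E_𝔞ᵢ(·, s)`**. As printed: `g = f - Σᵢ αᵢ E_𝔞ᵢ ∈ 𝒜_s` is bounded — in the
   cuspidal zones by the hypothesis and the growth of the `E_𝔞ᵢ` in all frames
   (`norm_eisCusp_frame_sub_cpow_le`, `norm_eisCusp_frame_le_of_ne`), on the rest by the compact
   core (`exists_compact_of_invHeight_le`, `exists_smul_mem_cuspStrip_of_lt`) — hence in `L²(F)`,
   "which implies `g = 0` because `Δ` has only non-negative eigenvalues in `𝓛(Γ\ℍ)`"
   (`ae_eq_zero_of_sqIntegrable_eigenfunction` of `L2EigenvalueNonneg`, then §1). The book's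
   hypothesis is the weaker `f ≪ e^{εy(z)}`, converted into `f(σ_𝔞z) = α_𝔞y^s + β_𝔞y^{1-s} + O(1)`
   by the Fourier expansion (Theorem 3.1); we start from the conclusion of that step (for
   `Re s > 1` the term `β y^{1-s}` is `O(1)`).

## References
* [Iwaniec2002] H. Iwaniec, *Spectral Methods of Automorphic Forms*, 2nd ed., GSM 53, AMS 2002,
  Lemma 6.4, PDF p. 86; (3.20), PDF p. 46; (4.3), PDF p. 48
  (held copy `book:iwaniec2002-spectral-methods-automorphic-forms`).

Mathlib: `MeasureTheory.measure_preimage_smul`, `measure_iUnion_null`, `ae_restrict_iff'`,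
`MemLp.of_bound`, `Real.rpow_le_one_of_one_le_of_nonpos`. Literature: `eisCusp`,
`isC2_and_eigen_eisCusp`, `isAutomorphic_eisCusp` (`FuchsianEisensteinSeries`); `eisGrowthConst`,
`norm_eisCusp_frame_sub_cpow_le`, `norm_eisCusp_frame_le_of_ne` (`FuchsianEisensteinGrowth`);
`invHeight`, `exists_compact_of_invHeight_le`, `exists_smul_mem_cuspStrip_of_lt`
(`FuchsianInvariantHeight`); `upperRightHom_one_mem_of_periods`, `cuspStrip` (`FuchsianCuspZones`);
`ae_eq_zero_of_sqIntegrable_eigenfunction` (`L2EigenvalueNonneg`); `isC2_finset_sum`,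
`hypLaplacian_finset_sum` (`SmallEigenbasisIndependence`); `IsC2.sub_const_mul`,
`hypLaplacian_sub_const_mul`, `IsC2.continuous` (`InvariantOperatorEigenfunctions`);
`eq_zero_of_continuous_of_ae_eq_zero` (`MaassCuspForms`). No uniqueness statement for Eisenstein
series of a general group existed (`lean search 'Lemma 6.4|eq_sum_eisCusp|uniqueness.*Eisenstein|ae_eq_zero_of_isAutomorphic'`: no hits).
-/

noncomputable section

namespace Literature.NumberTheory.Automorphic

open Matrix UpperHalfPlane
open scoped MatrixGroups

namespace Fuchsian

variable {Γ : Subgroup (GL (Fin 2) ℝ)} {F : Set ℍ}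

/-! ## 1. Automorphic functions vanishing a.e. on a fundamental domain -/

section AEZero

open _root_.MeasureTheory _root_.Set _root_.Filter
open scoped _root_.Pointwise _root_.ENNReal _root_.Topology

/-- **An automorphic function that vanishes a.e. on a fundamental domain vanishes a.e. on `ℍ`**
(`{g ≠ 0} ⊆ ⋃_{γ ∈ Γ} γ⁻¹{w ∈ F : g w ≠ 0}`, a countable union of null sets by the invariance of the
hyperbolic measure). [folklore] -/
theorem ae_eq_zero_of_isAutomorphic (hc : (Γ : Set (GL (Fin 2) ℝ)).Countable)
    (hF : IsHypFundamentalDomain Γ F) {g : ℍ → ℂ} (hga : IsAutomorphic Γ g)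
    (h0 : g =ᵐ[volume.restrict F] 0) : g =ᵐ[volume] 0 := by
  haveI : Countable Γ := hc.to_subtype
  set S : Set ℍ := {w | w ∈ F ∧ g w ≠ 0} with hS
  have hS0 : volume S = 0 := by
    have h1 : ∀ᵐ w ∂volume, w ∈ F → g w = 0 := by
      rw [← ae_restrict_iff' hF.measurableSet]
      filter_upwards [h0] with w hw
      exact hw
    rw [ae_iff] at h1
    refine measure_mono_null (fun w hw => ?_) h1
    simp only [mem_setOf_eq, not_forall, exists_prop]
    exact ⟨hw.1, hw.2⟩
  have hcover : {w | g w ≠ 0} ⊆ ⋃ γ : Γ, (fun w : ℍ => (γ : GL (Fin 2) ℝ) • w) ⁻¹' S := by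
    intro w hw
    obtain ⟨γ, hγ, hγF⟩ := hF.covers w
    refine mem_iUnion.mpr ⟨⟨γ, hγ⟩, ?_⟩
    refine ⟨hγF, ?_⟩
    rw [hga γ hγ w]
    exact hw
  have hnull : volume (⋃ γ : Γ, (fun w : ℍ => (γ : GL (Fin 2) ℝ) • w) ⁻¹' S) = 0 := by
    refine measure_iUnion_null fun γ => ?_
    rw [measure_preimage_smul]
    exact hS0
  rw [EventuallyEq, ae_iff]
  exact measure_mono_null (fun w hw => by simpa using hw) (measure_mono_null hcover hnull)

/-- … hence, if continuous, it vanishes identically. [folklore] -/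
theorem eq_zero_of_isAutomorphic_of_ae_restrict (hc : (Γ : Set (GL (Fin 2) ℝ)).Countable)
    (hF : IsHypFundamentalDomain Γ F) {g : ℍ → ℂ} (hga : IsAutomorphic Γ g) (hgc : Continuous g)
    (h0 : g =ᵐ[volume.restrict F] 0) : g = 0 :=
  eq_zero_of_continuous_of_ae_eq_zero hgc (ae_eq_zero_of_isAutomorphic hc hF hga h0)

end AEZero

/-! ## 2. Lemma 6.4: uniqueness of the Eisenstein series in `Re s > 1` -/

section Uniqueness

open _root_.MeasureTheory _root_.Set _root_.Filter
open scoped _root_.Pointwise _root_.ENNReal _root_.Topology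

variable {h : ℕ} {𝔞 : Fin h → OnePoint ℝ} {σ : Fin h → SL(2, ℝ)}

/-- Linear combinations of automorphic functions are automorphic. [folklore] -/
theorem isAutomorphic_sub_sum {f : ℍ → ℂ} (hf : IsAutomorphic Γ f) (α : Fin h → ℂ)
    {E : Fin h → ℍ → ℂ} (hE : ∀ i, IsAutomorphic Γ (E i)) :
    IsAutomorphic Γ (fun z => f z - 1 * ∑ i ∈ Finset.univ, α i * E i z) := by
  intro γ hγ z
  simp only [hf γ hγ z, fun i => hE i γ hγ z]

/-- **Iwaniec, Lemma 6.4 (uniqueness principle for `Re s > 1`).** Let `Γ` be a finite volume group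
(discrete `Γ ≤ SL₂(ℝ)`, `-1 ∈ Γ`, fundamental domain `F` of finite area) with a complete system of
inequivalent cusps `𝔞ᵢ = σᵢ∞` (width-one scaling matrices), and let `f ∈ 𝒜_s(Γ\ℍ)` — automorphic,
`C²`, `(Δ + s(1 - s))f = 0` — with `Re s > 1` satisfy the growth condition
`f(σᵢ z) = αᵢ y^s + O(1)` uniformly for `y ≥ 1` at every cusp. Then
`f(z) = Σᵢ αᵢ E_𝔞ᵢ(z, s)`. (Printed with the hypothesis `f ≪ e^{εy(z)}`, which through the Fourier
expansion gives `f(σ_𝔞 z) = α_𝔞 y^s + β_𝔞 y^{1-s} + O(1)`; we take the conclusion of that step as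
the hypothesis. Proof as printed: `g = f - Σ αᵢ E_𝔞ᵢ ∈ 𝒜_s ∩ L²(Γ\ℍ)` — bounded by the growth of
the `E_𝔞ᵢ` (`FuchsianEisensteinGrowth`) and the compact core — "which implies `g = 0` because `Δ`
has only non-negative eigenvalues in `𝓛(Γ\ℍ)`" (`ae_eq_zero_of_sqIntegrable_eigenfunction`).)
[cite: Iwaniec2002, Lemma 6.4, PDF p. 86] -/
theorem eq_sum_eisCusp_of_growth
    (hΓ : Γ ≤ (Matrix.SpecialLinearGroup.toGL : SL(2, ℝ) →* GL (Fin 2) ℝ).range)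
    (hneg : (-1 : GL (Fin 2) ℝ) ∈ Γ) (hd : IsDiscreteSubgroup Γ) (hF : IsHypFundamentalDomain Γ F)
    (hvol : volume F < ⊤)
    (hinfty : ∀ i, (Matrix.SpecialLinearGroup.toGL (σ i) : GL (Fin 2) ℝ) • (OnePoint.infty : OnePoint ℝ) = 𝔞 i)
    (hper : ∀ i, (ConjAct.toConjAct (Matrix.SpecialLinearGroup.toGL (σ i) : GL (Fin 2) ℝ)⁻¹ • Γ).strictPeriods =
      AddSubgroup.zmultiples 1)
    (hineq : ∀ i j, ∀ γ ∈ Γ, γ • 𝔞 i = 𝔞 j → i = j)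
    (hcomplete : ∀ c : OnePoint ℝ, IsCusp c Γ → ∃ i, ∃ γ ∈ Γ, γ • 𝔞 i = c)
    {s : ℂ} (hs : 1 < s.re) {f : ℍ → ℂ} (hfa : IsAutomorphic Γ f) (hfc : IsC2 f)
    (hfe : ∀ z, hypLaplacian f z + s * (1 - s) * f z = 0) (α : Fin h → ℂ)
    (hgrowth : ∃ C, ∀ (i : Fin h) (z : ℍ), 1 ≤ z.im →
      ‖f (σ i • z) - α i * ((z.im : ℝ) : ℂ) ^ s‖ ≤ C) :
    ∀ z, f z = ∑ i, α i * eisCusp Γ (σ i) z s := by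
  classical
  have ee : ∀ (x : SL(2, ℝ)) (w : ℍ), (Matrix.SpecialLinearGroup.toGL x : GL (Fin 2) ℝ) • w = x • w :=
    fun x w => rfl
  have hT : ∀ i, Matrix.GeneralLinearGroup.upperRightHom (1 : ℝ) ∈
      ConjAct.toConjAct (Matrix.SpecialLinearGroup.toGL (σ i) : GL (Fin 2) ℝ)⁻¹ • Γ :=
    fun i => upperRightHom_one_mem_of_periods (hper i)
  set E : Fin h → ℍ → ℂ := fun i z => eisCusp Γ (σ i) z s with hEdef
  have hE : ∀ i, Continuous (E i) ∧ IsC2 (E i) ∧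
      ∀ z, hypLaplacian (E i) z + s * (1 - s) * E i z = 0 :=
    fun i => isC2_and_eigen_eisCusp hΓ hd (σ i) (hT i) hs
  have hEa : ∀ i, IsAutomorphic Γ (E i) := fun i => isAutomorphic_eisCusp hΓ (σ i) s
  -- the difference `g`
  set Ssum : ℍ → ℂ := fun w => ∑ i ∈ Finset.univ, α i * E i w with hSsum
  have hSC2 : IsC2 Ssum := isC2_finset_sum Finset.univ α E fun i _ => (hE i).2.1
  have hSlap : ∀ z, hypLaplacian Ssum z = -(s * (1 - s)) * Ssum z := by
    intro z
    rw [hSsum, hypLaplacian_finset_sum Finset.univ α E (fun i _ => (hE i).2.1) z, Finset.mul_sum]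
    refine Finset.sum_congr rfl fun i _ => ?_
    have h := (hE i).2.2 z
    have : hypLaplacian (E i) z = -(s * (1 - s)) * E i z := by linear_combination h
    rw [this]; ring
  set g : ℍ → ℂ := fun w => f w - 1 * Ssum w with hgdef
  have hgC2 : IsC2 g := hfc.sub_const_mul hSC2 1
  have hge : ∀ z, hypLaplacian g z + s * (1 - s) * g z = 0 := by
    intro z
    rw [hgdef, hypLaplacian_sub_const_mul hfc hSC2 1 z, hSlap z]
    have h := hfe z
    linear_combination h
  have hga : IsAutomorphic Γ g := isAutomorphic_sub_sum hfa α hEa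
  have hgc : Continuous g := by
    refine hfc.continuous.sub (continuous_const.mul ?_)
    exact continuous_finsetSum _ fun i _ => continuous_const.mul (hE i).1
  -- `g` is bounded on `ℍ`
  obtain ⟨C, hC⟩ := hgrowth
  set c : ℝ := eisGrowthConst s.re with hc
  have hcpos : 0 < c := eisGrowthConst_pos hs
  set A : ℝ := ∑ i, ‖α i‖ with hA
  have hA0 : 0 ≤ A := Finset.sum_nonneg fun i _ => norm_nonneg _
  obtain ⟨K, hK, hcov⟩ := exists_compact_of_invHeight_le hΓ hneg hd hF hvol hinfty hper hcomplete 1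
  obtain ⟨M, hM⟩ := hK.exists_bound_of_continuousOn hgc.continuousOn
  have hframe : ∀ (j : Fin h) (u : ℍ), 1 ≤ u.im → ‖g (σ j • u)‖ ≤ C + A * c := by
    intro j u hu
    have hupos : 0 < u.im := u.im_pos
    -- `g(σⱼu) = (f(σⱼu) - αⱼ u^s) - Σᵢ αᵢ (Eᵢ(σⱼu) - δᵢⱼ u^s)`
    have e : g (σ j • u) = (f (σ j • u) - α j * ((u.im : ℝ) : ℂ) ^ s) -
        ∑ i, α i * (E i (σ j • u) - if i = j then ((u.im : ℝ) : ℂ) ^ s else 0) := by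
      simp only [hgdef, hSsum, one_mul, mul_sub, Finset.sum_sub_distrib, mul_ite, mul_zero,
        Finset.sum_ite_eq', Finset.mem_univ, if_true]
      ring
    rw [e]
    have hterm : ∀ i, ‖α i * (E i (σ j • u) - if i = j then ((u.im : ℝ) : ℂ) ^ s else 0)‖ ≤ ‖α i‖ * c := by
      intro i
      rw [norm_mul]
      refine mul_le_mul_of_nonneg_left ?_ (norm_nonneg _)
      have hp1 : u.im ^ (-s.re) ≤ 1 := Real.rpow_le_one_of_one_le_of_nonpos hu (by linarith)
      have hp2 : u.im ^ (1 - s.re) ≤ 1 := Real.rpow_le_one_of_one_le_of_nonpos hu (by linarith)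
      by_cases hij : i = j
      · subst hij
        rw [if_pos rfl]
        refine (norm_eisCusp_frame_sub_cpow_le hΓ hneg hd hper hs i u).trans ?_
        rw [← hc]; nlinarith
      · rw [if_neg hij, sub_zero]
        refine (norm_eisCusp_frame_le_of_ne hΓ hd hinfty hper hineq hs hij u).trans ?_
        rw [← hc]; nlinarith
    calc ‖(f (σ j • u) - α j * ((u.im : ℝ) : ℂ) ^ s) -
          ∑ i, α i * (E i (σ j • u) - if i = j then ((u.im : ℝ) : ℂ) ^ s else 0)‖
        ≤ ‖f (σ j • u) - α j * ((u.im : ℝ) : ℂ) ^ s‖ +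
          ‖∑ i, α i * (E i (σ j • u) - if i = j then ((u.im : ℝ) : ℂ) ^ s else 0)‖ := norm_sub_le _ _
      _ ≤ C + ∑ i, ‖α i‖ * c := by
          refine add_le_add (hC j u hu) ((norm_sum_le _ _).trans (Finset.sum_le_sum fun i _ => hterm i))
      _ = C + A * c := by rw [hA, Finset.sum_mul]
  have hbound : ∀ z, ‖g z‖ ≤ max M (C + A * c) := by
    intro z
    by_cases hle : invHeight Γ σ z ≤ 1
    · obtain ⟨γ, hγ, hγK⟩ := hcov z hle
      rw [← hga γ hγ z]
      exact (hM _ hγK).trans (le_max_left _ _)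
    · rw [not_le] at hle
      obtain ⟨γ, hγ, j, u, hu, e⟩ := exists_smul_mem_cuspStrip_of_lt hper zero_le_one hle
      rw [← hga γ hγ z, ← e, ee]
      exact (hframe j u hu.2.2.le).trans (le_max_right _ _)
  -- `g ∈ L²(F)` and the non-negativity of `Δ`
  haveI : IsFiniteMeasure (volume.restrict F) := isFiniteMeasure_restrict.mpr hvol.ne
  have hmem : MemLp g 2 (volume.restrict F) :=
    MemLp.of_bound hgc.aestronglyMeasurable _ (Eventually.of_forall hbound)
  have hae := ae_eq_zero_of_sqIntegrable_eigenfunction hΓ hneg hd hF hga hgC2 hge hmem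
    (by linarith) (Or.inr hs)
  have hg0 := eq_zero_of_isAutomorphic_of_ae_restrict hd.countable hF hga hgc hae
  intro z
  have := congrFun hg0 z
  simp only [hgdef, hSsum, one_mul, Pi.zero_apply, sub_eq_zero] at this
  exact this

end Uniqueness

end Fuchsian

end Literature.NumberTheory.Automorphic

end
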